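import Mathlib
import HarnessLib
import Summits.HubbardSuperconductivity.HubbardSuperconductivity.Theorems.KLProgrammeKLRegimeTwoVolumeDualReadoutRows
import Summits.HubbardSuperconductivity.HubbardSuperconductivity.Theorems.KLProgrammeKLRegimeTwoVolumeMomentumReadout

/-!
# Route `KLProgramme` — crux K3, VL child `KLRegimeVolumeLimitV17F2` (stmt-HubbardSuperconductivity-20440), ROUTE A bracket (A5) FOR THE VL STUB in
# the DUAL-LATTICE currency: the two-volume read-out of a self-energy string AT A COMMON GRID MOMENTUM from the pinned row defect of the
# position-space two-leg kernels — NO grid representation, NO resummation, NO partition functions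
# (cell gate-hubbard-kl, seat hubbard-kl-k3c5-p3 g9, technique «OS-positivity-free direct assembly»)

k3c5-p2 g7's `…TwoVolumeDualReadout(Rows)` reads the ENGINE child's local part (an interpolant on the Fermi curve) from the phase-weighted rows
`R_G(o; y) = Σ_{t₁} W_G(o,(t₁,o⃗+y))·e^{iω(t_o−t₁)}` of the position-space («dual-lattice») two-leg kernel `W_G = sectorisedKernel β (trivialMultiplier) G 2`
of ANY Grassmann element `G`, base-point independent as soon as `G`'s momentum two-leg kernel is diagonal (`rows_baseIndependent_klEffectiveAction_sub_counter`
for `G = 𝒱⁽ⁿ⁾[K] − 𝒩_K`, every `L, M, K, n, ω, σ`).  At a GRID momentum the read-out is simpler (no cosine coefficients, one sign of the offset):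

* §1 `torusFourierInv_selfEnergy_eq_dualRow` — ONE volume: the complex site kernel of the string `k⃗ ↦ Σ_G((ω,k⃗),σ)` IS `2ε·R_G(o;y)`, `ε = imagTimeWeight β M`
  (p1b's `card_sq_mul_sum_kernel_two_mul_torusChar` + `offsetSum_eq_sum_rows` + row invariance); `norm_selfEnergy_le_dualRows` (`‖Σ_G((ω,k),σ)‖ ≤ 2ε·Σ_y‖R_G(o;y)‖`).
* §2 **`norm_selfEnergy_sub_le_dualDefect_of_latticeMomentum_eq`** — TWO nested volumes `Lf = b·Lc`, same `M`, momenta with `p_{k″} = p_k`: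
  `‖Σ_{Gc}((ω,k),σ) − Σ_{Gf}((ω,k″),σ)‖ ≤ 2ε·(Σ_ȳ ‖R_c(o_c;ȳ) − R_f(o_f;ȳ↑)‖ + Σ_{y ≠ (red y)↑} ‖R_f(o_f;y)‖)` (Fourier inversion + Poisson on nested tori
  `norm_torusFourier_sub_torusFourier_of_latticeMomentum_eq` + «periodised ≤ pinned + far»).
* §3 **`norm_klSelfEnergy_sub_le_frame_add_dualDefect`** — THE MODEL, two frames: with `G_V = klEffectiveAction V M β U μ K_V klE0 n − counterQuadratic V M β K_V`
  (`Σ[𝒱[K]] = K(p) + Σ[G]`, [tree] `selfEnergy_counterQuadratic`) and ANY pins `o_c`, `o_f`: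
  `‖Σ^{Kc}_{Lc}(ω,k,σ) − Σ^{Kf}_{Lf}(ω,k″,σ)‖ ≤ |Kc(p) − Kf(p)| + 2ε·(Ddef₊ + Dfar₊)` — the `hrow`s discharged by k3c5-p2's lemma; the frame term is the tower's
  `flowFrames_twoVolume_of_towerV17F2` `O(1/L)`; NOTHING else (no unit partition function, no symbol calculus).

Proofs only; no definition; nothing is asserted about the model beyond identities.  References: BGM 2006 §2.1 (2.5), §2.4 (2.38); Salmhofer 1999 §4.3 (4.95);
Friedli–Velenik 2017 §10.4 (Poisson on nested tori).
-/

noncomputable section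

namespace Summit.HubbardSuperconductivity.HubbardSuperconductivity.Theorems.TwoVolumeDefect

set_option linter.dupNamespace false -- summit = problem name (single-conjunct summit), D-0017

open Finset Complex Literature.MathematicalPhysics.QuantumLattice Literature.Probability.LatticeModels GrassmannAlgebra
open Summit.HubbardSuperconductivity.HubbardSuperconductivity.Theorems.KLRegimeSplit
open Summit.HubbardSuperconductivity.HubbardSuperconductivity.Theorems.KLProgrammeLegKernels
open Summit.HubbardSuperconductivity.HubbardSuperconductivity.Theorems.TwoLegFourier
open scoped ComplexConjugate

/-! ## §1 One volume: the complex site kernel of a self-energy string is `2ε` times the dual-lattice row -/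

section OneVolume

variable {L M : ℕ} [NeZero L] [NeZero M]

/-- **The complex site kernel of `k⃗ ↦ Σ_G((ω,k⃗),σ)` is `2ε·R_G(o;y)`** under base-point independence of the phase-weighted rows (any pin `o`).
[cite: BenfattoGiulianiMastropietro2006, §2.1 (2.5)] -/
theorem torusFourierInv_selfEnergy_eq_dualRow {β : ℝ} (hβ : β ≠ 0) (G : HubbardGrassmann L M) (n : MatsubaraIdx M) (σ : Fin 2)
    (hrow : ∀ (x₀ x₀' : SpaceTimeIdx L M) (z : TorusSite 2 L),
      (∑ t₁ : ImagTimeIdx M,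
        sectorisedKernel L M β (trivialMultiplier L M) G 2 (![((0, σ), 0), ((0, σ), 1)] : Fin 2 → SectorLeg 1) ![x₀, (t₁, x₀.2 + z)] *
          Complex.exp (((matsubaraFreq β M n * (imagTime β M x₀.1 - imagTime β M t₁) : ℝ) : ℂ) * I)) =
      ∑ t₁ : ImagTimeIdx M,
        sectorisedKernel L M β (trivialMultiplier L M) G 2 (![((0, σ), 0), ((0, σ), 1)] : Fin 2 → SectorLeg 1) ![x₀', (t₁, x₀'.2 + z)] *
          Complex.exp (((matsubaraFreq β M n * (imagTime β M x₀'.1 - imagTime β M t₁) : ℝ) : ℂ) * I))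
    (o : SpaceTimeIdx L M) (y : TorusSite 2 L) :
    torusFourierInv (fun k : TorusSite 2 L => selfEnergy L M β G (n, k) σ) y =
      ((2 * imagTimeWeight β M : ℝ) : ℂ) *
        ∑ t₁ : ImagTimeIdx M,
          sectorisedKernel L M β (trivialMultiplier L M) G 2 (![((0, σ), 0), ((0, σ), 1)] : Fin 2 → SectorLeg 1) ![o, (t₁, o.2 + y)] *
            Complex.exp (((matsubaraFreq β M n * (imagTime β M o.1 - imagTime β M t₁) : ℝ) : ℂ) * I) := by
  set W := sectorisedKernel L M β (trivialMultiplier L M) G 2 (![((0, σ), 0), ((0, σ), 1)] : Fin 2 → SectorLeg 1) with hW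
  set R : ℂ := ∑ t₁ : ImagTimeIdx M, W ![o, (t₁, o.2 + y)] *
    Complex.exp (((matsubaraFreq β M n * (imagTime β M o.1 - imagTime β M t₁) : ℝ) : ℂ) * I) with hR
  have hPpos : 0 < Fintype.card (SpaceTimeIdx L M) := Fintype.card_pos_iff.2 ⟨(n, y)⟩
  have hPc : (Fintype.card (SpaceTimeIdx L M) : ℂ) ≠ 0 := by rw [Nat.cast_ne_zero]; exact hPpos.ne'
  have hLc : ((L : ℂ) ^ 2) ≠ 0 := pow_ne_zero 2 (by exact_mod_cast NeZero.ne L)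
  -- the character sum of the diagonal two-leg kernel is `L²·|Λ|·R/|Λ|²`
  have h := card_sq_mul_sum_kernel_two_mul_torusChar hβ G n σ y
  rw [← hW, offsetSum_eq_sum_rows] at h
  simp only [Matrix.cons_val_zero, Matrix.cons_val_one] at h
  have hconst : (∑ x₀ : SpaceTimeIdx L M, ∑ t₁ : ImagTimeIdx M, W ![x₀, (t₁, x₀.2 + y)] *
      Complex.exp (((matsubaraFreq β M n * (imagTime β M x₀.1 - imagTime β M t₁) : ℝ) : ℂ) * I)) =
      (Fintype.card (SpaceTimeIdx L M) : ℂ) * R := by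
    rw [sum_congr rfl fun x₀ _ => hrow x₀ o y, sum_const, card_univ, nsmul_eq_mul]
  rw [hconst] at h
  have hchar : ∑ k : TorusSite 2 L, kernel ℂ G 2 ![(((n, k), σ), 0), (((n, k), σ), 1)] * torusChar k y =
      (L : ℂ) ^ 2 / (Fintype.card (SpaceTimeIdx L M) : ℂ) * R := by
    have h' : (Fintype.card (SpaceTimeIdx L M) : ℂ) ^ 2 * ∑ k : TorusSite 2 L, kernel ℂ G 2 ![(((n, k), σ), 0), (((n, k), σ), 1)] * torusChar k y
        = (Fintype.card (SpaceTimeIdx L M) : ℂ) ^ 2 * ((L : ℂ) ^ 2 / (Fintype.card (SpaceTimeIdx L M) : ℂ) * R) := by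
      rw [h]; field_simp
    exact mul_left_cancel₀ (pow_ne_zero 2 hPc) h'
  -- the inverse torus Fourier transform
  rw [torusFourierInv_eq_sum_torusChar]
  have hsum : ∑ k : TorusSite 2 L, selfEnergy L M β G (n, k) σ * torusChar k y =
      ((2 * (β * (L : ℝ) ^ 2) : ℝ) : ℂ) * ∑ k : TorusSite 2 L, kernel ℂ G 2 ![(((n, k), σ), 0), (((n, k), σ), 1)] * torusChar k y := by
    rw [mul_sum]
    refine sum_congr rfl fun k _ => ?_
    rw [selfEnergy_eq_vertexFn, mul_assoc]
  rw [hsum, hchar]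
  -- `L⁻² · 2βL² · L²/|Λ| = 2ε`
  have hε : ((2 * imagTimeWeight β M : ℝ) : ℂ) = 2 * ((β * (L : ℝ) ^ 2 : ℝ) : ℂ) / (Fintype.card (SpaceTimeIdx L M) : ℂ) := by
    rw [eq_div_iff hPc]
    have h1 := imagTimeWeight_mul_card β L M
    have h2 : ((2 * imagTimeWeight β M : ℝ) : ℂ) * (Fintype.card (SpaceTimeIdx L M) : ℂ) =
        ((2 * (imagTimeWeight β M * Fintype.card (SpaceTimeIdx L M)) : ℝ) : ℂ) := by push_cast; ring
    rw [h2, h1]; push_cast; ring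
  rw [hε]
  push_cast
  field_simp

/-- **One-volume size**: `‖Σ_G((ω,k),σ)‖ ≤ 2ε·Σ_y ‖R_G(o;y)‖` (`0 ≤ β`). [cite: BenfattoGiulianiMastropietro2006, §2.1 (2.5)] -/
theorem norm_selfEnergy_le_dualRows {β : ℝ} (hβ : 0 < β) (G : HubbardGrassmann L M) (n : MatsubaraIdx M) (σ : Fin 2)
    (hrow : ∀ (x₀ x₀' : SpaceTimeIdx L M) (z : TorusSite 2 L),
      (∑ t₁ : ImagTimeIdx M,
        sectorisedKernel L M β (trivialMultiplier L M) G 2 (![((0, σ), 0), ((0, σ), 1)] : Fin 2 → SectorLeg 1) ![x₀, (t₁, x₀.2 + z)] *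
          Complex.exp (((matsubaraFreq β M n * (imagTime β M x₀.1 - imagTime β M t₁) : ℝ) : ℂ) * I)) =
      ∑ t₁ : ImagTimeIdx M,
        sectorisedKernel L M β (trivialMultiplier L M) G 2 (![((0, σ), 0), ((0, σ), 1)] : Fin 2 → SectorLeg 1) ![x₀', (t₁, x₀'.2 + z)] *
          Complex.exp (((matsubaraFreq β M n * (imagTime β M x₀'.1 - imagTime β M t₁) : ℝ) : ℂ) * I))
    (o : SpaceTimeIdx L M) (k : TorusSite 2 L) :
    ‖selfEnergy L M β G (n, k) σ‖ ≤ 2 * imagTimeWeight β M * ∑ y : TorusSite 2 L,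
      ‖∑ t₁ : ImagTimeIdx M,
          sectorisedKernel L M β (trivialMultiplier L M) G 2 (![((0, σ), 0), ((0, σ), 1)] : Fin 2 → SectorLeg 1) ![o, (t₁, o.2 + y)] *
            Complex.exp (((matsubaraFreq β M n * (imagTime β M o.1 - imagTime β M t₁) : ℝ) : ℂ) * I)‖ := by
  have hε : 0 ≤ 2 * imagTimeWeight β M := by have := imagTimeWeight_nonneg hβ.le M; positivity
  rw [eq_torusFourier_torusFourierInv (fun k : TorusSite 2 L => selfEnergy L M β G (n, k) σ) k]
  refine (norm_torusFourier_le_sum_norm _ k).trans ?_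
  rw [mul_sum]
  refine sum_le_sum fun y _ => ?_
  rw [torusFourierInv_selfEnergy_eq_dualRow hβ.ne' G n σ hrow o y, norm_mul, Complex.norm_real, Real.norm_eq_abs, abs_of_nonneg hε]

end OneVolume

/-! ## §2 Two nested volumes at a common grid momentum -/

section TwoVolumes

variable {Lc Lf b M : ℕ} [NeZero Lc] [NeZero Lf] [NeZero M]

/-- **THE DUAL READ-OUT AT A COMMON GRID MOMENTUM.**  `Lf = b·Lc`, the same `M`, `0 < β`, Grassmann elements `Gc`, `Gf` with base-point independent
phase-weighted rows, ANY pins `o_c`, `o_f`, and momenta `k`, `k″` with `p_{k″} = p_k`: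
`‖Σ_{Gc}((ω,k),σ) − Σ_{Gf}((ω,k″),σ)‖ ≤ 2ε·(Σ_ȳ ‖R_c(o_c;ȳ) − R_f(o_f;ȳ↑)‖ + Σ_{y ≠ (red y)↑} ‖R_f(o_f;y)‖)` (`ȳ↑ = proj (cRep ȳ)` the centred lift).
[cite: BenfattoGiulianiMastropietro2006, §2.4 (2.38)] -/
theorem norm_selfEnergy_sub_le_dualDefect_of_latticeMomentum_eq (hL : Lf = b * Lc) {β : ℝ} (hβ : 0 < β)
    (Gc : HubbardGrassmann Lc M) (Gf : HubbardGrassmann Lf M) (n : MatsubaraIdx M) (σ : Fin 2)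
    (hrowc : ∀ (x₀ x₀' : SpaceTimeIdx Lc M) (z : TorusSite 2 Lc),
      (∑ t₁ : ImagTimeIdx M,
        sectorisedKernel Lc M β (trivialMultiplier Lc M) Gc 2 (![((0, σ), 0), ((0, σ), 1)] : Fin 2 → SectorLeg 1) ![x₀, (t₁, x₀.2 + z)] *
          Complex.exp (((matsubaraFreq β M n * (imagTime β M x₀.1 - imagTime β M t₁) : ℝ) : ℂ) * I)) =
      ∑ t₁ : ImagTimeIdx M,
        sectorisedKernel Lc M β (trivialMultiplier Lc M) Gc 2 (![((0, σ), 0), ((0, σ), 1)] : Fin 2 → SectorLeg 1) ![x₀', (t₁, x₀'.2 + z)] *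
          Complex.exp (((matsubaraFreq β M n * (imagTime β M x₀'.1 - imagTime β M t₁) : ℝ) : ℂ) * I))
    (hrowf : ∀ (x₀ x₀' : SpaceTimeIdx Lf M) (z : TorusSite 2 Lf),
      (∑ t₁ : ImagTimeIdx M,
        sectorisedKernel Lf M β (trivialMultiplier Lf M) Gf 2 (![((0, σ), 0), ((0, σ), 1)] : Fin 2 → SectorLeg 1) ![x₀, (t₁, x₀.2 + z)] *
          Complex.exp (((matsubaraFreq β M n * (imagTime β M x₀.1 - imagTime β M t₁) : ℝ) : ℂ) * I)) =
      ∑ t₁ : ImagTimeIdx M,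
        sectorisedKernel Lf M β (trivialMultiplier Lf M) Gf 2 (![((0, σ), 0), ((0, σ), 1)] : Fin 2 → SectorLeg 1) ![x₀', (t₁, x₀'.2 + z)] *
          Complex.exp (((matsubaraFreq β M n * (imagTime β M x₀'.1 - imagTime β M t₁) : ℝ) : ℂ) * I))
    (oc : SpaceTimeIdx Lc M) (of : SpaceTimeIdx Lf M)
    {k : TorusSite 2 Lc} {k'' : TorusSite 2 Lf} (hk : latticeMomentum Lf k'' = latticeMomentum Lc k) :
    ‖selfEnergy Lc M β Gc (n, k) σ - selfEnergy Lf M β Gf (n, k'') σ‖ ≤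
      2 * imagTimeWeight β M *
        ((∑ ybar : TorusSite 2 Lc,
            ‖(∑ t₁ : ImagTimeIdx M,
                sectorisedKernel Lc M β (trivialMultiplier Lc M) Gc 2 (![((0, σ), 0), ((0, σ), 1)] : Fin 2 → SectorLeg 1) ![oc, (t₁, oc.2 + ybar)] *
                  Complex.exp (((matsubaraFreq β M n * (imagTime β M oc.1 - imagTime β M t₁) : ℝ) : ℂ) * I)) -
              (∑ t₁ : ImagTimeIdx M,
                sectorisedKernel Lf M β (trivialMultiplier Lf M) Gf 2 (![((0, σ), 0), ((0, σ), 1)] : Fin 2 → SectorLeg 1)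
                    ![of, (t₁, of.2 + Torus.proj Lf (Torus.cRep ybar))] *
                  Complex.exp (((matsubaraFreq β M n * (imagTime β M of.1 - imagTime β M t₁) : ℝ) : ℂ) * I))‖) +
          ∑ y ∈ univ.filter (fun y : TorusSite 2 Lf => Torus.proj Lf (Torus.cRep (fun i => (((y i).val : ℕ) : ZMod Lc))) ≠ y),
            ‖∑ t₁ : ImagTimeIdx M,
                sectorisedKernel Lf M β (trivialMultiplier Lf M) Gf 2 (![((0, σ), 0), ((0, σ), 1)] : Fin 2 → SectorLeg 1) ![of, (t₁, of.2 + y)] *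
                  Complex.exp (((matsubaraFreq β M n * (imagTime β M of.1 - imagTime β M t₁) : ℝ) : ℂ) * I)‖) := by
  classical
  have hε : 0 ≤ 2 * imagTimeWeight β M := by have := imagTimeWeight_nonneg hβ.le M; positivity
  set σc : TorusSite 2 Lc → ℂ := torusFourierInv (fun k : TorusSite 2 Lc => selfEnergy Lc M β Gc (n, k) σ) with hσc
  set σf : TorusSite 2 Lf → ℂ := torusFourierInv (fun k : TorusSite 2 Lf => selfEnergy Lf M β Gf (n, k) σ) with hσf
  rw [eq_torusFourier_torusFourierInv (fun k : TorusSite 2 Lc => selfEnergy Lc M β Gc (n, k) σ) k,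
    eq_torusFourier_torusFourierInv (fun k : TorusSite 2 Lf => selfEnergy Lf M β Gf (n, k) σ) k'']
  refine (TwoPointAssembly.norm_torusFourier_sub_torusFourier_of_latticeMomentum_eq hL σc σf hk).trans ?_
  refine (TwoPointAssembly.sum_norm_sub_periodise_le_pinned_add_far hL σc σf).trans ?_
  rw [mul_add]
  refine add_le_add ?_ ?_
  · rw [mul_sum]
    refine sum_le_sum fun ybar _ => ?_
    rw [hσc, hσf, torusFourierInv_selfEnergy_eq_dualRow hβ.ne' Gc n σ hrowc oc ybar,
      torusFourierInv_selfEnergy_eq_dualRow hβ.ne' Gf n σ hrowf of (Torus.proj Lf (Torus.cRep ybar)), ← mul_sub, norm_mul,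
      Complex.norm_real, Real.norm_eq_abs, abs_of_nonneg hε]
  · rw [mul_sum]
    refine sum_le_sum fun y _ => ?_
    rw [hσf, torusFourierInv_selfEnergy_eq_dualRow hβ.ne' Gf n σ hrowf of y, norm_mul, Complex.norm_real, Real.norm_eq_abs,
      abs_of_nonneg hε]

end TwoVolumes

/-! ## §3 The model: two volumes, two frames, the separated data `𝒱⁽ⁿ⁾[K] − 𝒩_K` (rows base-point free) -/

section Model

variable {Lc Lf b M : ℕ} [NeZero Lc] [NeZero Lf] [NeZero M]

/-- **Frame vertex reproduced exactly at a grid momentum**: `Σ[𝒱⁽ⁿ⁾[K]](k,σ) = K(p_k⃗) + Σ[𝒱⁽ⁿ⁾[K] − 𝒩_K](k,σ)`. [cite: FeldmanSalmhoferTrubowitz1996, §1] -/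
theorem klSelfEnergy_eq_eval_add_selfEnergy_sub_counter {L : ℕ} [NeZero L] {β : ℝ} (hβ : β ≠ 0) (U μ : ℝ) (K : TrigPolyC4v) (n : ℕ)
    (k : FreqMomentum L M) (σ : Fin 2) :
    klSelfEnergy L M β U μ K klE0 n k σ =
      ((K.eval (latticeMomentum L k.2) : ℝ) : ℂ) + selfEnergy L M β (klEffectiveAction L M β U μ K klE0 n - counterQuadratic L M β K) k σ := by
  rw [klSelfEnergy]
  have hsub : selfEnergy L M β (klEffectiveAction L M β U μ K klE0 n - counterQuadratic L M β K) k σ =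
      selfEnergy L M β (klEffectiveAction L M β U μ K klE0 n) k σ - selfEnergy L M β (counterQuadratic L M β K) k σ := by
    simp only [selfEnergy_eq_vertexFn, TwoLegFourier.kernel_sub', mul_sub]
  rw [hsub, selfEnergy_counterQuadratic hβ K k σ]
  ring

/-- **THE VL READ-OUT IN DUAL CURRENCY, TWO FRAMES.**  `0 < β`, `Lf = b·Lc`, common `M`, frames `Kc`/`Kf`, scale `n`, label `ω`, spin `σ`, ANY pins
`o_c`, `o_f`, momenta with `p_{k″} = p_k`; `G_V := klEffectiveAction V M β U μ K_V klE0 n − counterQuadratic V M β K_V`: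
`‖klSelfEnergy Lc … Kc klE0 n (ω,k) σ − klSelfEnergy Lf … Kf klE0 n (ω,k″) σ‖ ≤ |Kc(p) − Kf(p)| + 2ε·(Ddef₊ + Dfar₊)` — the rows are base-point free by
k3c5-p2's `rows_baseIndependent_klEffectiveAction_sub_counter`; no partition function, no resummation.  [cite: BenfattoGiulianiMastropietro2006, §2.4 (2.38)] -/
theorem norm_klSelfEnergy_sub_le_frame_add_dualDefect (hL : Lf = b * Lc) {β : ℝ} (hβ : 0 < β) (U μ : ℝ) (Kc Kf : TrigPolyC4v) (n : ℕ)
    (ω : MatsubaraIdx M) (σ : Fin 2) (oc : SpaceTimeIdx Lc M) (of : SpaceTimeIdx Lf M)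
    {k : TorusSite 2 Lc} {k'' : TorusSite 2 Lf} (hk : latticeMomentum Lf k'' = latticeMomentum Lc k) :
    ‖klSelfEnergy Lc M β U μ Kc klE0 n (ω, k) σ - klSelfEnergy Lf M β U μ Kf klE0 n (ω, k'') σ‖ ≤
      |Kc.eval (latticeMomentum Lc k) - Kf.eval (latticeMomentum Lc k)| +
        2 * imagTimeWeight β M *
          ((∑ ybar : TorusSite 2 Lc,
              ‖(∑ t₁ : ImagTimeIdx M,
                  sectorisedKernel Lc M β (trivialMultiplier Lc M) (klEffectiveAction Lc M β U μ Kc klE0 n - counterQuadratic Lc M β Kc) 2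
                      (![((0, σ), 0), ((0, σ), 1)] : Fin 2 → SectorLeg 1) ![oc, (t₁, oc.2 + ybar)] *
                    Complex.exp (((matsubaraFreq β M ω * (imagTime β M oc.1 - imagTime β M t₁) : ℝ) : ℂ) * I)) -
                (∑ t₁ : ImagTimeIdx M,
                  sectorisedKernel Lf M β (trivialMultiplier Lf M) (klEffectiveAction Lf M β U μ Kf klE0 n - counterQuadratic Lf M β Kf) 2
                      (![((0, σ), 0), ((0, σ), 1)] : Fin 2 → SectorLeg 1) ![of, (t₁, of.2 + Torus.proj Lf (Torus.cRep ybar))] *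
                    Complex.exp (((matsubaraFreq β M ω * (imagTime β M of.1 - imagTime β M t₁) : ℝ) : ℂ) * I))‖) +
            ∑ y ∈ univ.filter (fun y : TorusSite 2 Lf => Torus.proj Lf (Torus.cRep (fun i => (((y i).val : ℕ) : ZMod Lc))) ≠ y),
              ‖∑ t₁ : ImagTimeIdx M,
                  sectorisedKernel Lf M β (trivialMultiplier Lf M) (klEffectiveAction Lf M β U μ Kf klE0 n - counterQuadratic Lf M β Kf) 2
                      (![((0, σ), 0), ((0, σ), 1)] : Fin 2 → SectorLeg 1) ![of, (t₁, of.2 + y)] *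
                    Complex.exp (((matsubaraFreq β M ω * (imagTime β M of.1 - imagTime β M t₁) : ℝ) : ℂ) * I)‖) := by
  rw [klSelfEnergy_eq_eval_add_selfEnergy_sub_counter hβ.ne' U μ Kc n (ω, k) σ,
    klSelfEnergy_eq_eval_add_selfEnergy_sub_counter hβ.ne' U μ Kf n (ω, k'') σ]
  simp only []
  rw [hk, add_sub_add_comm]
  refine (norm_add_le _ _).trans (add_le_add ?_ ?_)
  · rw [← Complex.ofReal_sub, Complex.norm_real, Real.norm_eq_abs]
  · exact norm_selfEnergy_sub_le_dualDefect_of_latticeMomentum_eq hL hβ _ _ ω σ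
      (rows_baseIndependent_klEffectiveAction_sub_counter hβ.ne' U μ Kc n ω σ)
      (rows_baseIndependent_klEffectiveAction_sub_counter hβ.ne' U μ Kf n ω σ) oc of hk

end Model

end Summit.HubbardSuperconductivity.HubbardSuperconductivity.Theorems.TwoVolumeDefect
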